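import Literature.AlgebraicGeometry.Modules.CechLocalizedSectionsCounit
import Literature.AlgebraicGeometry.Modules.CechOrderedBicomplex
import Literature.AlgebraicGeometry.Modules.HypercohomologyAffineSections
import Literature.AlgebraicGeometry.Modules.QuasiIsoOfAffineSections
import Literature.Algebra.Homology.QuasiIsoCriterionAb
import Mathlib.RingTheory.Flat.Basic
import HarnessLib

/-!
# The counit `P̌ⁿ(𝓤, I•) → Čⁿ(𝓤, I•)` is a quasi-isomorphism for a `Γ`-acyclic complex with quasi-coherent cohomology

Let `X` be a scheme, `𝓤 = (U_i)` a family of opens whose `(n+1)`-fold intersections `U_α` are affine, and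
`I•` a bounded-below cochain complex of `𝒪_X`-modules whose terms are acyclic on affine opens (e.g. injective)
and whose cohomology sheaves `𝓗^q(I•)` are affine-localizing (quasi-coherent). For the localized-sections
sheaves `P̌ⁿ(𝓤, F)` (`V ↦ Π_α Γ(X, V ⊓ U_α) ⊗_{Γ(X, U_α)} Γ(F, U_α)`, sheafified;
`Modules/CechLocalizedSections`) and their counit `P̌ⁿ(𝓤, F) → Čⁿ(𝓤, F)` to the Čech sheaves
(`V ↦ Π_α Γ(F, V ⊓ U_α)`), we prove that the induced morphism of complexes

`P̌ⁿ(𝓤, I•) ⟶ Čⁿ(𝓤, I•)`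

is a QUASI-ISOMORPHISM, provided the affine opens `V` with all `V ⊓ U_α` affine form a basis of `X` (e.g. `X`
separated). This is the heart of the comparison `D⁺(QCoh X) → D⁺_qc(X)` via the "coherator" Čech resolution
(Görtz–Wedhorn II, Lemma 22.36; Thomason–Trobaugh B.16; Stacks 08D6/0CRX): on a good affine `V` the sections
are `Π_α B_α ⊗_{A_α} Γ(U_α, I•) → Π_α Γ(V ⊓ U_α, I•)` (`toObj_app_bijective`), and each factor is a
quasi-isomorphism because `B_α` is flat over `A_α` (`flat_base`), `Hʲ(Γ(W, I•)) = Γ(W, 𝓗ʲ)` on the affines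
`W = U_α, V ⊓ U_α` (`Modules/HypercohomologyAffineSections`) and
`B_α ⊗_{A_α} Γ(U_α, 𝓗ʲ) = Γ(V ⊓ U_α, 𝓗ʲ)` (`counitPiece_bijective`).

* `PCech.functor`, `Cech.functor`, `PCech.counitNatTrans` — the functors `F ↦ P̌ⁿ(𝓤, F)`, `F ↦ Čⁿ(𝓤, F)` and the
  counit as a natural transformation;
* `PCech.exists_cycle_counitPiece_eq`, `PCech.exists_mapPiece_eq_of_counitPiece_eq` — the two elementwise
  halves (surjectivity / injectivity on cohomology) for one piece;
* `PCech.quasiIso_sections_counit` — on a good affine `V` the map of section complexes is a quasi-isomorphism;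
* `PCech.quasiIso_counit_mapHomologicalComplex` — the theorem.

Everything is proved; no named facts, no instances. Mathlib searched (pin v4.32): `Module.Flat.lTensor_exact`,
`Module.Flat.lTensor_preserves_injective_linearMap`, `lTensor_exact`, `LinearMap.lTensor_surjective`,
`NatTrans.mapHomologicalComplex`; nothing on Čech/coherator comparisons exists in Mathlib.

## References

* U. Görtz, T. Wedhorn, *Algebraic Geometry II*, Springer (2023), Lemma 22.36 and its proof (pp. 349–350),
  Thm. 22.35. [GortzWedhorn2023]
* R. W. Thomason, T. Trobaugh, *Higher algebraic K-theory of schemes and of derived categories*, in: The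
  Grothendieck Festschrift III, Progr. Math. 88 (1990), Appendix B, B.16. [ThomasonTrobaugh1990]
* R. Hartshorne, *Algebraic Geometry*, GTM 52 (1977), III Lemma 4.2, Prop. 8.5. [Hartshorne1977]
-/

noncomputable section

-- `TopCat.Presheaf`/`Scheme.Modules` are not reducible (as in Mathlib's `AlgebraicGeometry/Modules`).
set_option backward.isDefEq.respectTransparency false

open CategoryTheory CategoryTheory.Limits AlgebraicGeometry TopologicalSpace Opposite TensorProduct

universe u

namespace Literature.AlgebraicGeometry.Modules

variable {X : Scheme.{u}} {ι : Type u} (U : ι → X.Opens) (n : ℕ)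

/-! ## §1 The functors `P̌ⁿ(𝓤, –)`, `Čⁿ(𝓤, –)` and the counit as a natural transformation -/

namespace Cech

/-- `Čⁿ(𝓤, 0) = 0`. [cite: Hartshorne1977, III Lemma 4.2 (p. 220)] -/
theorem map_zero' (M N : X.Modules) : Cech.map U n M (0 : M ⟶ N) = 0 := by
  have h := Cech.map_add U n (M := M) (N := N) 0 0
  rw [add_zero] at h
  exact left_eq_add.mp h

/-- **The functor `F ↦ Čⁿ(𝓤, F)`**. [cite: Hartshorne1977, III Lemma 4.2 (p. 220)] -/
def functor : X.Modules ⥤ X.Modules where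
  obj M := Cech.obj U n M
  map φ := Cech.map U n _ φ
  map_id M := Cech.map_id U n M
  map_comp φ ψ := Cech.map_comp U n _ φ ψ

/-- `Čⁿ(𝓤, –)` on objects. [cite: Hartshorne1977, III Lemma 4.2 (p. 220)] -/
@[simp] theorem functor_obj (M : X.Modules) : (functor U n).obj M = Cech.obj U n M := rfl

/-- `Čⁿ(𝓤, –)` on morphisms. [cite: Hartshorne1977, III Lemma 4.2 (p. 220)] -/
@[simp] theorem functor_map {M N : X.Modules} (φ : M ⟶ N) : (functor U n).map φ = Cech.map U n M φ := rfl

/-- `Čⁿ(𝓤, –)` preserves zero morphisms. [cite: Hartshorne1977, III Lemma 4.2 (p. 220)] -/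
theorem preservesZeroMorphisms_functor : (functor U n).PreservesZeroMorphisms :=
  ⟨fun M N => map_zero' U n M N⟩

end Cech

namespace PCech

variable {F G : X.Modules}

/-- `P̌ⁿ(𝓤, 0) = 0` at presheaf level. [cite: GortzWedhorn2023, Lemma 22.36 (p. 349)] -/
theorem presheafMap_zero : presheafMap U n (0 : F ⟶ G) = 0 := by
  have h := presheafMap_add U n (F := F) (G := G) 0 0
  rw [add_zero] at h
  exact left_eq_add.mp h

/-- `P̌ⁿ(𝓤, 0) = 0`. [cite: GortzWedhorn2023, Lemma 22.36 (p. 349)] -/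
theorem map_zero' : map U n (0 : F ⟶ G) = 0 := by
  rw [map, presheafMap_zero, Functor.map_zero]

variable (F G)

/-- **The functor `F ↦ P̌ⁿ(𝓤, F)`**. [cite: GortzWedhorn2023, Lemma 22.36 (p. 349)] -/
def functor : X.Modules ⥤ X.Modules where
  obj F := PCech.obj U n F
  map φ := PCech.map U n φ
  map_id F := PCech.map_id U n (F := F)
  map_comp φ ψ := PCech.map_comp U n φ ψ

/-- `P̌ⁿ(𝓤, –)` on objects. [cite: GortzWedhorn2023, Lemma 22.36 (p. 349)] -/
@[simp] theorem functor_obj : (functor U n).obj F = PCech.obj U n F := rfl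

/-- `P̌ⁿ(𝓤, –)` on morphisms. [cite: GortzWedhorn2023, Lemma 22.36 (p. 349)] -/
@[simp] theorem functor_map {F G : X.Modules} (φ : F ⟶ G) : (functor U n).map φ = PCech.map U n φ := rfl

/-- `P̌ⁿ(𝓤, –)` preserves zero morphisms. [cite: GortzWedhorn2023, Lemma 22.36 (p. 349)] -/
theorem preservesZeroMorphisms_functor : (functor U n).PreservesZeroMorphisms :=
  ⟨fun _ _ => map_zero' U n⟩

/-- **The counit `P̌ⁿ(𝓤, –) ⟶ Čⁿ(𝓤, –)` as a natural transformation.** [cite: GortzWedhorn2023, Lemma 22.36 (p. 349)] -/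
def counitNatTrans : functor U n ⟶ Cech.functor U n where
  app F := PCech.counit U n F
  naturality _ _ φ := PCech.map_counit U n φ

/-- Components of the counit transformation. [cite: GortzWedhorn2023, Lemma 22.36 (p. 349)] -/
@[simp] theorem counitNatTrans_app : (counitNatTrans U n).app F = PCech.counit U n F := rfl

/-! ### Elementwise forms of the unit, functoriality and counit on a section `s ∈ Π_α Piece V α` -/

variable {F G}

/-- Components of `P̌ⁿ(𝓤, φ)` at presheaf level. [cite: GortzWedhorn2023, Lemma 22.36 (p. 349)] -/
theorem presheafMap_app_apply (φ : F ⟶ G) (V : X.Opens) (s : Sections U n F V) (α : Fin (n + 1) → ι) :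
    ((presheafMap U n φ).app (op V) s : Sections U n G V) α = mapPiece U n φ V α (s α) := rfl

variable (F) in
/-- Components of the presheaf counit. [cite: GortzWedhorn2023, Lemma 22.36 (p. 349)] -/
theorem counitPresheaf_app_apply (V : X.Opens) (s : Sections U n F V) (α : Fin (n + 1) → ι) :
    ((counitPresheaf U n F).app (op V) s : Cech.Sections U n F V) α = counitPiece U n F V α (s α) := rfl

/-- **`P̌ⁿ(𝓤, φ) ∘ η = η ∘ (Π_α b ⊗ m ↦ b ⊗ φ m)`** on sections over `V` (naturality of the unit `η`).
[cite: GortzWedhorn2023, Lemma 22.36 (p. 349)] -/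
theorem map_app_toObj_app (φ : F ⟶ G) (V : X.Opens) (s : Sections U n F V) :
    (map U n φ).app V ((toObj U n F).app (op V) s) = (toObj U n G).app (op V) ((presheafMap U n φ).app (op V) s) := by
  have h := congrArg (fun f : presheafMod U n F ⟶ _ => (f.app (op V)).hom s) (presheafMap_toObj U n φ)
  exact h.symm

variable (F) in
/-- **`counit ∘ η = (Π_α counitPiece)`** on sections over `V`. [cite: GortzWedhorn2023, Lemma 22.36 (p. 349)] -/
theorem counit_app_toObj_app (V : X.Opens) (s : Sections U n F V) :
    (counit U n F).app V ((toObj U n F).app (op V) s) = (counitPresheaf U n F).app (op V) s := by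
  have h := congrArg (fun f : presheafMod U n F ⟶ _ => (f.app (op V)).hom s) (toObj_counit U n F)
  exact h

/-! ## §2 One piece: `B ⊗_A Γ(U_α, I•) → Γ(V ⊓ U_α, I•)` induces a bijection on cohomology (elementwise) -/

section Piece

variable {F G : X.Modules} (V : X.Opens) (α : Fin (n + 1) → ι)

/-- `P̌(0) = 0` on a piece. [cite: GortzWedhorn2023, Lemma 22.36 (p. 349)] -/
theorem mapPiece_zero (x : Piece U n F V α) : mapPiece U n (0 : F ⟶ G) V α x = 0 := by
  induction x using induction_on with
  | zero => exact map_zero _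
  | tmul b m => rw [mapPiece_tmul, Scheme.Modules.Hom.zero_app]; exact TensorProduct.tmul_zero _ b
  | add x y hx hy => rw [map_add, hx, hy, add_zero]

/-- `b ⊗ m ↦ b ⊗ φ(m)` IS `1_B ⊗ φ_{U_α}` (Mathlib `LinearMap.lTensor`). [cite: GortzWedhorn2023, Lemma 22.36 (p. 349)] -/
theorem coe_mapPiece_eq_lTensor (φ : F ⟶ G) :
    ⇑(mapPiece U n φ V α) = ⇑(LinearMap.lTensor Γ(X, V ⊓ face U α) (appLinear φ (face U α))) := rfl

variable (I : CochainComplex X.Modules ℤ)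

/-- `0 → Γ(O, Zʲ) → Γ(O, Iʲ) → Γ(O, Iʲ⁺¹)` is exact (sections are left exact). [cite: Hartshorne1977, III §1 (p. 203)] -/
theorem exact_iCycles_app_d_app (j k : ℤ) (hjk : j + 1 = k) (O : X.Opens) :
    Function.Exact (appLinear (I.iCycles j) O) (appLinear (I.d j k) O) := by
  intro y
  constructor
  · intro hy
    obtain ⟨z, hz⟩ := exists_iCycles_app_eq I j k (by simp only [CochainComplex.next]; omega) O y hy
    exact ⟨z, hz⟩
  · rintro ⟨z, rfl⟩
    exact d_app_iCycles_app I j k O z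

variable (hI : ∀ (q : ℤ) ⦃O : X.Opens⦄, IsAffineOpen O → IsAcyclicOn (I.X q) O)
  (hH : ∀ q : ℤ, IsAffineLocalizing (I.homology q)) (a : ℤ) [I.IsStrictlyGE a]
include hI hH a

/-- `Γ(O, Iⁱ) → Γ(O, Zʲ) → Γ(O, 𝓗ʲ) → 0` is exact on an AFFINE `O` (`Modules/HypercohomologyAffineSections`).
[cite: GortzWedhorn2023, proof of Lemma 22.36 (p. 350)] -/
theorem exact_toCycles_app_homologyπ_app (i j : ℤ) (hij : i + 1 = j) ⦃O : X.Opens⦄ (hO : IsAffineOpen O) :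
    Function.Exact (appLinear (I.toCycles i j) O) (appLinear (I.homologyπ j) O) := by
  obtain rfl : i = j - 1 := by omega
  intro z
  rw [appLinear_apply, homologyπ_app_eq_zero_iff_of_isAcyclicOn_X hI hH a j hO z]
  rfl

variable {V} (hα : IsAffineOpen (face U α)) (hV : IsAffineOpen V) (hVα : IsAffineOpen (V ⊓ face U α))
include hα hV hVα

/-- **Surjectivity half**: every cocycle `z ∈ Γ(V ⊓ U_α, Iʲ)` is, up to a coboundary, the image under the counit
`b ⊗ m ↦ b • m|` of a cocycle of `B ⊗_A Γ(U_α, I•)` (`B = Γ(X, V ⊓ U_α)`, `A = Γ(X, U_α)`; uses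
`Hʲ(Γ(W, I•)) = Γ(W, 𝓗ʲ)` on the affines `W = U_α, V ⊓ U_α` and the quasi-coherent base change
`B ⊗_A Γ(U_α, 𝓗ʲ) = Γ(V ⊓ U_α, 𝓗ʲ)`). [cite: GortzWedhorn2023, proof of Lemma 22.36 (p. 350)]
[cite: ThomasonTrobaugh1990, Appendix B, B.16] -/
theorem exists_cycle_counitPiece_eq (j : ℤ) (z : Γ(I.X j, V ⊓ face U α))
    (hz : (I.d j (j + 1)).app (V ⊓ face U α) z = 0) :
    ∃ x : Piece U n (I.X j) V α, mapPiece U n (I.d j (j + 1)) V α x = 0 ∧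
      ∃ c : Γ(I.X (j - 1), V ⊓ face U α),
        counitPiece U n (I.X j) V α x = z + (I.d (j - 1) j).app (V ⊓ face U α) c := by
  obtain ⟨ζ', hζ'⟩ := exists_iCycles_app_eq I j (j + 1) (by simp only [CochainComplex.next]) (V ⊓ face U α) z hz
  have hsurjπ : Function.Surjective (mapPiece U n (I.homologyπ j) V α) := by
    rw [coe_mapPiece_eq_lTensor]
    exact LinearMap.lTensor_surjective _ (homologyπ_app_surjective_of_isAcyclicOn_X hI hH a j hα)
  obtain ⟨t, ht⟩ := (counitPiece_bijective U n (I.homology j) α hα hV hVα (hH j)).2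
    ((I.homologyπ j).app (V ⊓ face U α) ζ')
  obtain ⟨τ, hτ⟩ := hsurjπ t
  refine ⟨mapPiece U n (I.iCycles j) V α τ, ?_, ?_⟩
  · rw [← mapPiece_comp, HomologicalComplex.iCycles_d, mapPiece_zero]
  · have hπ : (I.homologyπ j).app (V ⊓ face U α) (counitPiece U n (I.cycles j) V α τ) =
        (I.homologyπ j).app (V ⊓ face U α) ζ' := by
      rw [← counitPiece_mapPiece, hτ, ht]
    have h0 : (I.homologyπ j).app (V ⊓ face U α) (counitPiece U n (I.cycles j) V α τ - ζ') = 0 := by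
      rw [map_sub, hπ, sub_self]
    obtain ⟨c, hc⟩ := (homologyπ_app_eq_zero_iff_of_isAcyclicOn_X hI hH a j hVα _).1 h0
    refine ⟨c, ?_⟩
    rw [counitPiece_mapPiece]
    have e := congrArg ((I.iCycles j).app (V ⊓ face U α)) hc
    rw [iCycles_app_toCycles_app, map_sub, hζ'] at e
    rw [e, add_sub_cancel]

/-- **Injectivity half**: a cocycle of `B ⊗_A Γ(U_α, I•)` whose image under the counit is a coboundary is a
coboundary (uses FLATNESS of `B` over `A` for `B ⊗ Γ(U_α, Zʲ⁺¹) = Z(B ⊗ Γ(U_α, I•))ʲ⁺¹`, right exactness of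
`B ⊗ –`, `Hʲ⁺¹(Γ(U_α, I•)) = Γ(U_α, 𝓗ʲ⁺¹)` and injectivity of the quasi-coherent base change for `𝓗ʲ⁺¹`).
[cite: GortzWedhorn2023, proof of Lemma 22.36 (p. 350)] [cite: ThomasonTrobaugh1990, Appendix B, B.16] -/
theorem exists_mapPiece_eq_of_counitPiece_eq (j : ℤ) (x : Piece U n (I.X (j + 1)) V α)
    (hx : mapPiece U n (I.d (j + 1) (j + 2)) V α x = 0)
    (hb : ∃ c : Γ(I.X j, V ⊓ face U α),
      counitPiece U n (I.X (j + 1)) V α x = (I.d j (j + 1)).app (V ⊓ face U α) c) :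
    ∃ x₁ : Piece U n (I.X j) V α, mapPiece U n (I.d j (j + 1)) V α x₁ = x := by
  haveI := flat_base U n V α hα hVα
  -- Step 1 (flatness): `x = (1 ⊗ ι)(τ)` for a `τ ∈ B ⊗ Γ(U_α, Zʲ⁺¹)`
  have hex₁ : Function.Exact (mapPiece U n (I.iCycles (j + 1)) V α) (mapPiece U n (I.d (j + 1) (j + 2)) V α) := by
    rw [coe_mapPiece_eq_lTensor, coe_mapPiece_eq_lTensor]
    exact Module.Flat.lTensor_exact Γ(X, V ⊓ face U α) (exact_iCycles_app_d_app I (j + 1) (j + 2) (by omega) _)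
  obtain ⟨τ, hτ⟩ := (hex₁ x).1 hx
  -- Step 2: `(1 ⊗ π)(τ) = 0` by injectivity of the base change for `𝓗ʲ⁺¹`
  obtain ⟨c, hc⟩ := hb
  have hcounit : counitPiece U n (I.cycles (j + 1)) V α τ = (I.toCycles j (j + 1)).app (V ⊓ face U α) c := by
    apply iCycles_app_injective I (j + 1) (V ⊓ face U α)
    rw [iCycles_app_toCycles_app, ← hc, ← counitPiece_mapPiece, hτ]
  have ht : mapPiece U n (I.homologyπ (j + 1)) V α τ = 0 := by
    apply (counitPiece_bijective U n (I.homology (j + 1)) α hα hV hVα (hH (j + 1))).1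
    rw [map_zero, counitPiece_mapPiece, hcounit, homologyπ_app_toCycles_app]
  -- Step 3 (right exactness): `τ = (1 ⊗ toCycles)(x₁)`
  have hex₂ : Function.Exact (mapPiece U n (I.toCycles j (j + 1)) V α) (mapPiece U n (I.homologyπ (j + 1)) V α) := by
    rw [coe_mapPiece_eq_lTensor, coe_mapPiece_eq_lTensor]
    exact lTensor_exact Γ(X, V ⊓ face U α) (exact_toCycles_app_homologyπ_app I hI hH a j (j + 1) rfl hα)
      (homologyπ_app_surjective_of_isAcyclicOn_X hI hH a (j + 1) hα)
  obtain ⟨x₁, hx₁⟩ := (hex₂ τ).1 ht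
  refine ⟨x₁, ?_⟩
  rw [← I.toCycles_i j (j + 1), mapPiece_comp, hx₁, hτ]

end Piece

/-! ## §3 The counit `P̌ⁿ(𝓤, I•) → Čⁿ(𝓤, I•)` is a quasi-isomorphism -/

section Complexes

variable (I : CochainComplex X.Modules ℤ)

/-- **`P̌ⁿ(𝓤, I•)`**: the functor `P̌ⁿ(𝓤, –)` applied termwise. [cite: GortzWedhorn2023, Lemma 22.36 (p. 349)] -/
def complexP : CochainComplex X.Modules ℤ :=
  haveI := preservesZeroMorphisms_functor U n
  ((functor U n).mapHomologicalComplex (ComplexShape.up ℤ)).obj I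

/-- **`Čⁿ(𝓤, I•)`**: the functor `Čⁿ(𝓤, –)` applied termwise. [cite: Hartshorne1977, III Lemma 4.2 (p. 220)] -/
def complexC : CochainComplex X.Modules ℤ :=
  haveI := Cech.preservesZeroMorphisms_functor U n
  ((Cech.functor U n).mapHomologicalComplex (ComplexShape.up ℤ)).obj I

/-- Terms of `P̌ⁿ(𝓤, I•)`. [cite: GortzWedhorn2023, Lemma 22.36 (p. 349)] -/
@[simp] theorem complexP_X (j : ℤ) : (complexP U n I).X j = PCech.obj U n (I.X j) := rfl

/-- Differentials of `P̌ⁿ(𝓤, I•)`. [cite: GortzWedhorn2023, Lemma 22.36 (p. 349)] -/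
@[simp] theorem complexP_d (j k : ℤ) : (complexP U n I).d j k = PCech.map U n (I.d j k) := rfl

/-- Terms of `Čⁿ(𝓤, I•)`. [cite: Hartshorne1977, III Lemma 4.2 (p. 220)] -/
@[simp] theorem complexC_X (j : ℤ) : (complexC U n I).X j = Cech.obj U n (I.X j) := rfl

/-- Differentials of `Čⁿ(𝓤, I•)`. [cite: Hartshorne1977, III Lemma 4.2 (p. 220)] -/
@[simp] theorem complexC_d (j k : ℤ) : (complexC U n I).d j k = Cech.map U n (I.X j) (I.d j k) := rfl

/-- **The counit `P̌ⁿ(𝓤, I•) ⟶ Čⁿ(𝓤, I•)`** (termwise). [cite: GortzWedhorn2023, Lemma 22.36 (p. 349)] -/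
def counitComplexMap : complexP U n I ⟶ complexC U n I :=
  haveI := preservesZeroMorphisms_functor U n
  haveI := Cech.preservesZeroMorphisms_functor U n
  (NatTrans.mapHomologicalComplex (counitNatTrans U n) (ComplexShape.up ℤ)).app I

/-- Components of the counit on complexes. [cite: GortzWedhorn2023, Lemma 22.36 (p. 349)] -/
@[simp] theorem counitComplexMap_f (j : ℤ) : (counitComplexMap U n I).f j = PCech.counit U n (I.X j) := rfl

variable (hI : ∀ (q : ℤ) ⦃O : X.Opens⦄, IsAffineOpen O → IsAcyclicOn (I.X q) O)
  (hH : ∀ q : ℤ, IsAffineLocalizing (I.homology q)) (a : ℤ) [I.IsStrictlyGE a]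
  (hfaces : ∀ α : Fin (n + 1) → ι, IsAffineOpen (face U α))
include hI hH a hfaces

/-- **On a good affine open `V` (affine, all `V ⊓ U_α` affine) the map of section complexes
`Γ(V, P̌ⁿ(𝓤, I•)) → Γ(V, Čⁿ(𝓤, I•))` is a quasi-isomorphism**: through `η_V` (`toObj_app_bijective`) it is
`Π_α (B_α ⊗ Γ(U_α, I•) → Γ(V ⊓ U_α, I•))`, and the elementwise criterion `quasiIso_of_surj_inj_ab` is fed by
`exists_cycle_counitPiece_eq` / `exists_mapPiece_eq_of_counitPiece_eq` componentwise.
[cite: GortzWedhorn2023, proof of Lemma 22.36 (p. 350)] [cite: ThomasonTrobaugh1990, Appendix B, B.16] -/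
theorem quasiIso_sections_counitComplexMap {V : X.Opens} (hV : IsAffineOpen V)
    (hVα : ∀ α : Fin (n + 1) → ι, IsAffineOpen (V ⊓ face U α)) :
    QuasiIso ((sectionsComplexFunctor X V).map (counitComplexMap U n I)) := by
  refine Literature.Algebra.Homology.quasiIso_of_surj_inj_ab _ (fun j z hz => ?_) (fun j x hx hb => ?_)
  · -- surjectivity on `Hʲ`
    change (Cech.map U n (I.X j) (I.d j (j + 1))).app V z = 0 at hz
    have hzα : ∀ α, (I.d j (j + 1)).app (V ⊓ face U α) ((z : Cech.Sections U n (I.X j) V) α) = 0 := fun α => by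
      have h := congrFun hz α
      rwa [Cech.map_app_apply, Cech.obj_zero_apply] at h
    choose xs hxs c hc using fun α =>
      exists_cycle_counitPiece_eq U n α I hI hH a (hfaces α) hV (hVα α) j ((z : Cech.Sections U n (I.X j) V) α) (hzα α)
    refine ⟨(toObj U n (I.X j)).app (op V) xs, ?_, (fun α => c α : Cech.Sections U n (I.X (j - 1)) V), ?_⟩
    · change (PCech.map U n (I.d j (j + 1))).app V ((toObj U n (I.X j)).app (op V) xs) = 0
      rw [map_app_toObj_app]
      have h0 : (presheafMap U n (I.d j (j + 1))).app (op V) xs = 0 :=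
        funext fun α => by rw [presheafMap_app_apply, hxs, zero_apply]
      rw [h0, map_zero]
    · change (PCech.counit U n (I.X j)).app V ((toObj U n (I.X j)).app (op V) xs) =
        (show Γ(Cech.obj U n (I.X j), V) from z) +
          (Cech.map U n (I.X (j - 1)) (I.d (j - 1) j)).app V (fun α => c α : Cech.Sections U n (I.X (j - 1)) V)
      rw [counit_app_toObj_app]
      funext α
      rw [counitPresheaf_app_apply, hc, Cech.obj_add_apply, Cech.map_app_apply]
  · -- injectivity on `Hʲ⁺¹`
    obtain ⟨xs, rfl⟩ := (toObj_app_bijective U n (I.X (j + 1)) hV hVα).2 x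
    change (PCech.map U n (I.d (j + 1) (j + 2))).app V ((toObj U n (I.X (j + 1))).app (op V) xs) = 0 at hx
    rw [map_app_toObj_app] at hx
    have hx0 : (presheafMap U n (I.d (j + 1) (j + 2))).app (op V) xs = 0 :=
      (toObj_app_bijective U n (I.X (j + 2)) hV hVα).1 (by rw [hx, map_zero])
    obtain ⟨c, hc⟩ := hb
    change (PCech.counit U n (I.X (j + 1))).app V ((toObj U n (I.X (j + 1))).app (op V) xs) =
      (Cech.map U n (I.X j) (I.d j (j + 1))).app V c at hc
    rw [counit_app_toObj_app] at hc
    have H := fun α => exists_mapPiece_eq_of_counitPiece_eq U n α I hI hH a (hfaces α) hV (hVα α) j (xs α)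
      (by have h := congrFun hx0 α; rwa [presheafMap_app_apply, zero_apply] at h)
      ⟨(c : Cech.Sections U n (I.X j) V) α, by
        have h := congrFun hc α; rwa [counitPresheaf_app_apply, Cech.map_app_apply] at h⟩
    choose x₁ hx₁ using H
    refine ⟨(toObj U n (I.X j)).app (op V) x₁, ?_⟩
    change (PCech.map U n (I.d j (j + 1))).app V ((toObj U n (I.X j)).app (op V) x₁) =
      (toObj U n (I.X (j + 1))).app (op V) xs
    rw [map_app_toObj_app]
    congr 1
    funext α
    rw [presheafMap_app_apply, hx₁]

/-- **The counit `P̌ⁿ(𝓤, I•) → Čⁿ(𝓤, I•)` is a QUASI-ISOMORPHISM** for a bounded-below complex `I•` with terms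
acyclic on affines and affine-localizing (quasi-coherent) cohomology sheaves, when the faces `U_α` are affine and
the affine opens `V` with all `V ⊓ U_α` affine form a basis of `X` (e.g. `X` separated): quasi-isomorphisms of
complexes of `𝒪_X`-modules are detected on the section complexes over a basis
(`Modules/QuasiIsoOfAffineSections`). This is the row-wise input for the comparison of the total complexes
`Tot P̌(𝓤, I•) → Tot Č(𝓤, I•) ← I•` (Görtz–Wedhorn II, Lemma 22.36; Thomason–Trobaugh B.16).
[cite: GortzWedhorn2023, Lemma 22.36 (p. 349)] [cite: ThomasonTrobaugh1990, Appendix B, B.16] -/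
theorem quasiIso_counitComplexMap
    (hgood : Opens.IsBasis {V : X.Opens | IsAffineOpen V ∧ ∀ α : Fin (n + 1) → ι, IsAffineOpen (V ⊓ face U α)}) :
    QuasiIso (counitComplexMap U n I) :=
  quasiIso_of_quasiIso_sections hgood _ fun _ hV =>
    quasiIso_sections_counitComplexMap U n I hI hH a hfaces hV.1 hV.2

end Complexes

end PCech

end Literature.AlgebraicGeometry.Modules

end
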